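/-
Copyright (c) 2026 the pub-hodgecm-mathlib formalisation cell (harness21).  Prover seat hodgecm-mathlib-K2E4-p10 (g8), Track B «K2-LIT»,
#184♮ = hLiu418 = `stmt-HodgeConjecture-24832`; socket #41, KIND W, letter (L-supp) of ★ `K2LiuWhittakerWeightedGrowthInstance` — the local-to-global
denominator bookkeeping.  THEOREMS ONLY (no `def`, no `instance`, no notation, no named-fact hypothesis, no `sorry`); Mathlib-only.
-/
import Mathlib.NumberTheory.NumberField.Basic
import Mathlib.RingTheory.DedekindDomain.AdicValuation
import Mathlib.RingTheory.Ideal.Norm.AbsNorm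
import Mathlib.Data.Matrix.Basic
import HarnessLib

/-!
# Crux `HLiu418`, socket #41, KIND W — `K2LiuGlobalDenominatorOfLocalBounds`: A GLOBAL DENOMINATOR FROM LOCAL VALUATION BOUNDS

Cell `hodgecm-mathlib`, crux item hLiu418 = `stmt-HodgeConjecture-24832` (helper lane `--supports … --as helper`, count-neutral), route of record `HCCMUnconditional`;
squad K2 ∕ K2Liu, road `K2_Liu`, socket #41, KIND W.  CONSUMER: the support letter (L-supp) of ★ `K2LiuWhittakerWeightedGrowthInstance.exists_whittaker_factorLetters_weight`
— `A S s h ≠ 0 → ∃ D : ℕ, 1 ≤ D ∧ (D : ℝ) ≤ C₀·‖h‖^κ ∧ ∀ i j, IsIntegral ℤ ((D : L) * S i j)` — whose payers obtain, place by place, that the Fourier index `S` lies in the dual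
lattice of the level of `h_v` (★ Φ5 F4a `K2LiuBadPlaceWhittakerShells.setIntegral_eq_zero_of_unipotent_translate`, good places: `S` `v`-integral), i.e. LOCAL valuation bounds
`|S_{ij}|_w ≤ q_w^{m_w}` with `m_w = 0` off a finite set `T`.  This file turns such local bounds into the GLOBAL denominator the letter asks for.

THE MATHEMATICS ([NeukirchANT1999, Ch. I §3, Ch. II §3]; [CasselsFrohlich1967, Ch. II §4]).  For `x ∈ L` with `v_w(x) ≥ −m_w` at every finite place `w` of `L` (`m_w = 0` for
`w ∉ T`), the natural number `D = ∏_{w∈T} N(𝔭_w)^{m_w}` satisfies `D·x ∈ 𝓞_L`: `N(𝔭_w) ∈ 𝔭_w` (Mathlib `Ideal.absNorm_mem`), so `v_w(D) ≥ m_w` for `w ∈ T` and `≥ 0`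
elsewhere, whence `v_w(D·x) ≥ 0` for all `w`, and an element of `L` that is integral at every finite place is in `𝓞_L` (Mathlib `mem_integers_of_valuation_le_one`).
* §1 `one_le_prod_absNorm_pow`, `valuation_prod_absNorm_pow_le` — `D ≥ 1` and `|D|_w ≤ q_w^{−m_w}`.
* §2 **`isIntegral_prod_absNorm_pow_mul`** — `IsIntegral ℤ (D·x)` from the local bounds `Valued.v (x : L_w) ≤ exp(m_w)`.
* §3 **`exists_den_of_valuation_le`** — the matrix form in the (L-supp) currency: `∃ D, 1 ≤ D ∧ (D : ℝ) ≤ B ∧ ∀ i j, IsIntegral ℤ ((D : L) * S i j)` as soon as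
  `∏_{w∈T} N(𝔭_w)^{m_w} ≤ B` (the payer bounds `B` by `C₀·‖h‖^κ` from the finite height of `h`).
HONEST LABEL.  Count-neutral helper; `HC_CM` is proved only modulo the 7 printed citations (2 remaining named inputs: hLiu418 = `stmt-HodgeConjecture-24832`,
h413 = `stmt-HodgeConjecture-24833`) until rung 0 closes; this file closes no socket.

## References
* [NeukirchANT1999] J. Neukirch, *Algebraic Number Theory*, Grundlehren 322 (1999), Ch. I §3 (ideals, norms), Ch. II §3 (valuations).
* [CasselsFrohlich1967] J. W. S. Cassels, A. Fröhlich (eds.), *Algebraic Number Theory* (1967), Ch. II §4 (global fields, product of local conditions).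
-/

set_option autoImplicit false
set_option linter.dupNamespace false -- the mandated namespace repeats `HodgeConjecture.HodgeConjecture`

noncomputable section

namespace Summit.HodgeConjecture.HodgeConjecture.Cruxes.HLiu418.K2LiuGlobalDenominatorOfLocalBounds

open scoped BigOperators
open NumberField IsDedekindDomain

variable (L : Type) [Field L] [NumberField L]

/-! ## §1 The denominator `D = ∏_{w∈T} N(𝔭_w)^{m_w}` -/

/-- `D = ∏_{w∈T} N(𝔭_w)^{m_w} ≥ 1` (every `𝔭_w ≠ 0` has `N(𝔭_w) ≥ 1`). [cite: NeukirchANT1999, Ch. I §3] -/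
theorem one_le_prod_absNorm_pow (T : Finset (HeightOneSpectrum (𝓞 L))) (m : HeightOneSpectrum (𝓞 L) → ℕ) :
    1 ≤ ∏ w ∈ T, Ideal.absNorm w.asIdeal ^ m w :=
  Nat.one_le_iff_ne_zero.2 (Finset.prod_ne_zero_iff.2 fun w _ => pow_ne_zero _ (by
    rw [Ne, Ideal.absNorm_eq_zero_iff]; exact w.ne_bot))

/-- **`|D|_w ≤ q_w^{−m_w}`** for `D = ∏_{w′∈T} N(𝔭_{w′})^{m_{w′}}` and `m = 0` off `T`: `N(𝔭_w)^{m_w} ∈ 𝔭_w^{m_w}` divides `D` (`N(𝔭) ∈ 𝔭`, Mathlib `Ideal.absNorm_mem`).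
[cite: NeukirchANT1999, Ch. I §3] -/
theorem valuation_prod_absNorm_pow_le (T : Finset (HeightOneSpectrum (𝓞 L))) (m : HeightOneSpectrum (𝓞 L) → ℕ) (hm : ∀ w ∉ T, m w = 0)
    (w : HeightOneSpectrum (𝓞 L)) :
    w.valuation L (((∏ w' ∈ T, Ideal.absNorm w'.asIdeal ^ m w' : ℕ) : L)) ≤ WithZero.exp (-(m w : ℤ)) := by
  classical
  have hcast : (((∏ w' ∈ T, Ideal.absNorm w'.asIdeal ^ m w' : ℕ) : L)) =
      algebraMap (𝓞 L) L ((∏ w' ∈ T, Ideal.absNorm w'.asIdeal ^ m w' : ℕ) : 𝓞 L) := (map_natCast _ _).symm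
  rw [hcast, HeightOneSpectrum.valuation_of_algebraMap, HeightOneSpectrum.intValuation_le_pow_iff_mem]
  by_cases hw : w ∈ T
  · have hmem : ((Ideal.absNorm w.asIdeal ^ m w : ℕ) : 𝓞 L) ∈ w.asIdeal ^ m w := by
      rw [Nat.cast_pow]
      exact Ideal.pow_mem_pow (Ideal.absNorm_mem w.asIdeal) (m w)
    have hsplit : ((∏ w' ∈ T, Ideal.absNorm w'.asIdeal ^ m w' : ℕ) : 𝓞 L) =
        ((∏ w' ∈ T.erase w, Ideal.absNorm w'.asIdeal ^ m w' : ℕ) : 𝓞 L) * ((Ideal.absNorm w.asIdeal ^ m w : ℕ) : 𝓞 L) := by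
      rw [← Nat.cast_mul, Finset.prod_erase_mul T (fun w' => Ideal.absNorm w'.asIdeal ^ m w') hw]
    rw [hsplit]
    exact Ideal.mul_mem_left _ _ hmem
  · rw [hm w hw, pow_zero, Ideal.one_eq_top]
    exact Submodule.mem_top

/-! ## §2 Local bounds ⟹ global denominator -/

/-- **LOCAL VALUATION BOUNDS ⟹ A GLOBAL DENOMINATOR.**  If `x ∈ L` satisfies `|x|_w ≤ q_w^{m_w}` (i.e. `v_w(x) ≥ −m_w`) at every finite place `w`, with `m_w = 0` off the finite
set `T`, then `D·x` is integral over `ℤ` for `D = ∏_{w∈T} N(𝔭_w)^{m_w}`: `|D·x|_w ≤ q_w^{−m_w}·q_w^{m_w} = 1` for all `w` (`valuation_prod_absNorm_pow_le`), and integrality at every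
finite place means membership in `𝓞_L` (Mathlib `mem_integers_of_valuation_le_one`). [cite: NeukirchANT1999, Ch. II §3] [cite: CasselsFrohlich1967, Ch. II §4] -/
theorem isIntegral_prod_absNorm_pow_mul (x : L) (T : Finset (HeightOneSpectrum (𝓞 L))) (m : HeightOneSpectrum (𝓞 L) → ℕ) (hm : ∀ w ∉ T, m w = 0)
    (hx : ∀ w : HeightOneSpectrum (𝓞 L), Valued.v (x : w.adicCompletion L) ≤ WithZero.exp (m w : ℤ)) :
    IsIntegral ℤ ((((∏ w ∈ T, Ideal.absNorm w.asIdeal ^ m w : ℕ) : L)) * x) := by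
  have hle : ∀ w : HeightOneSpectrum (𝓞 L), w.valuation L ((((∏ w' ∈ T, Ideal.absNorm w'.asIdeal ^ m w' : ℕ) : L)) * x) ≤ 1 := by
    intro w
    rw [Valuation.map_mul]
    have h1 := valuation_prod_absNorm_pow_le L T m hm w
    have h2 : w.valuation L x ≤ WithZero.exp (m w : ℤ) := by
      rw [← HeightOneSpectrum.valuedAdicCompletion_eq_valuation']
      exact hx w
    calc w.valuation L (((∏ w' ∈ T, Ideal.absNorm w'.asIdeal ^ m w' : ℕ) : L)) * w.valuation L x
        ≤ WithZero.exp (-(m w : ℤ)) * WithZero.exp (m w : ℤ) := mul_le_mul' h1 h2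
      _ = 1 := by rw [← WithZero.exp_add, neg_add_cancel, WithZero.exp_zero]
  obtain ⟨y, hy⟩ := RingHom.mem_range.1 (HeightOneSpectrum.mem_integers_of_valuation_le_one (R := 𝓞 L) (K := L) _ hle)
  rw [← hy]
  exact RingOfIntegers.isIntegral_coe y

/-- the same with the trivial bound everywhere (`T = ∅`): an element integral at every finite place is integral over `ℤ`. [cite: NeukirchANT1999, Ch. II §3] -/
theorem isIntegral_of_valuation_le_one (x : L) (hx : ∀ w : HeightOneSpectrum (𝓞 L), Valued.v (x : w.adicCompletion L) ≤ 1) : IsIntegral ℤ x := by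
  have h := isIntegral_prod_absNorm_pow_mul L x ∅ (fun _ => 0) (fun _ _ => rfl) (fun w => by simpa using hx w)
  simpa using h

/-! ## §3 The matrix form, in the currency of the (L-supp) letter -/

/-- **THE (L-supp) DENOMINATOR FROM LOCAL LATTICE BOUNDS.**  If every entry of `S ∈ M_n(L)` satisfies `|S_{ij}|_w ≤ q_w^{m_w}` at every finite place `w` (`m = 0` off `T`) and
`∏_{w∈T} N(𝔭_w)^{m_w} ≤ B`, then `∃ D : ℕ, 1 ≤ D ∧ (D : ℝ) ≤ B ∧ ∀ i j, IsIntegral ℤ ((D : L) * S i j)` — the conclusion of the support letter of ★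
`K2LiuWhittakerWeightedGrowthInstance.exists_whittaker_factorLetters_weight` (there `B = C₀·‖h‖^κ`). [cite: NeukirchANT1999, Ch. II §3] [cite: CasselsFrohlich1967, Ch. II §4] -/
theorem exists_den_of_valuation_le {n : ℕ} (S : Matrix (Fin n) (Fin n) L) (T : Finset (HeightOneSpectrum (𝓞 L))) (m : HeightOneSpectrum (𝓞 L) → ℕ)
    (hm : ∀ w ∉ T, m w = 0) (hS : ∀ i j (w : HeightOneSpectrum (𝓞 L)), Valued.v ((S i j : L) : w.adicCompletion L) ≤ WithZero.exp (m w : ℤ))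
    {B : ℝ} (hB : ((∏ w ∈ T, Ideal.absNorm w.asIdeal ^ m w : ℕ) : ℝ) ≤ B) :
    ∃ D : ℕ, 1 ≤ D ∧ (D : ℝ) ≤ B ∧ ∀ i j, IsIntegral ℤ ((D : L) * S i j) :=
  ⟨∏ w ∈ T, Ideal.absNorm w.asIdeal ^ m w, one_le_prod_absNorm_pow L T m, hB, fun i j => isIntegral_prod_absNorm_pow_mul L (S i j) T m hm (hS i j)⟩

/-- numerics of the denominator: `(∏_{w∈T} N(𝔭_w)^{m_w} : ℝ) = ∏_{w∈T} (N(𝔭_w) : ℝ)^{m_w}` and it is `≤ ∏_{w∈T} B_w` whenever `N(𝔭_w)^{m_w} ≤ B_w` on `T` (the payer takes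
`B_w = H_w(h)^κ`-type local height bounds). [cite: NeukirchANT1999, Ch. I §3] -/
theorem cast_prod_absNorm_pow_le (T : Finset (HeightOneSpectrum (𝓞 L))) (m : HeightOneSpectrum (𝓞 L) → ℕ) (Bw : HeightOneSpectrum (𝓞 L) → ℝ)
    (hBw : ∀ w ∈ T, ((Ideal.absNorm w.asIdeal : ℕ) : ℝ) ^ m w ≤ Bw w) :
    ((∏ w ∈ T, Ideal.absNorm w.asIdeal ^ m w : ℕ) : ℝ) ≤ ∏ w ∈ T, Bw w := by
  rw [Nat.cast_prod]
  refine Finset.prod_le_prod (fun w _ => by positivity) fun w hw => ?_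
  rw [Nat.cast_pow]
  exact hBw w hw

end Summit.HodgeConjecture.HodgeConjecture.Cruxes.HLiu418.K2LiuGlobalDenominatorOfLocalBounds

end
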